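import Literature.Computability.Complexity.BakerGillSolovay
import Literature.Computability.Complexity.AlgebraicQueryLemma
import Literature.Computability.Complexity.StructuralPH
import HarnessLib

/-!
# Aaronson–Wigderson Thm. 5.3: oracles `A, Ã` with `NP^A ⊄ P^Ã` (proof of `aaronson_wigderson_separation`)

Trunk `CplxCore`, companion of `Algebrization.lean` / `StructuralPH.lean` and of the tree's
Baker–Gill–Solovay proof (`BakerGillSolovay.lean`). We PROVE, with no hypothesis, the named fact
`Literature.Computability.Complexity.aaronson_wigderson_separation` (`StructuralPH.lean`;
S. Aaronson, A. Wigderson, *Algebrization: a new barrier in complexity theory*, STOC 2008, full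
version Thm. 5.3, pp. 23–24: "There exist `A, Ã` such that `NP^A ⊄ P^Ã`. Furthermore, the
language `L` that achieves the separation simply corresponds to deciding, on inputs of length `n`,
whether there exists a `w ∈ {0,1}ⁿ` with `Aₙ(w) = 1`"), in the tree's transcript model of oracle
computation (`PRel`, `NPRel`, `Oracle.ofLanguage`, `ExtensionOracle.toOracle`, prime fields):

* `Literature.Computability.Complexity.aaronson_wigderson_separation_holds` —
  `∃ A Ã d, Ã.IsExtensionOf A d ∧ ¬ NP^A ⊆ P^Ã`, with `d = 2` (`Ã` multiquadratic over every
  prime field, as in AW's proof).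

## The proof (AW pp. 23–24, following Baker–Gill–Solovay)

"Our proof closely follows the usual diagonalization argument of Baker, Gill, and Solovay, except
that we have to use Lemma 4.5 to handle the fact that `P` can query a low-degree extension"
(AW p. 24). The algebra is the tree's `Multilinear.exists_multiquadratic_toggle`
(`AlgebraicQueryLemma.lean`: AW Lemmas 4.2, 4.3 and 4.5 for all prime fields at once); the
diagonalization is the one of `BGS.oracleB` (`BakerGillSolovay.lean`), whose enumeration
`BGS.exists_enum_pair` of the (polynomial-time oracle algorithm, polynomial) pairs `(Mᵢ, qᵢ)`
(AW: "let `M₁, M₂, …` be an enumeration of `DTIME(n^{log n})` oracle machines"; here each machine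
comes with its own polynomial clock, which is what membership in `P^Ã` provides), fresh lengths
`BGS.lvl` (`n > N` with `qᵢ(n) < 2ⁿ`; AW: "`2ⁿ > n^{log n}`") and separating language
`BGS.U A = {x | ∃ y, |y| ≤ |x|, ⟨x, y⟩ ∈ A} ∈ NP^A` (`BGS.U_mem_NPRel`) are reused. As there, the
strings put into `A` have the form `⟨1ⁿ, y⟩` with `|y| = n` (length `3n + 2`), so that
`1ⁿ ∈ U_A ⇔ ∃ w ∈ {0,1}ⁿ, ⟨1ⁿ, w⟩ ∈ A` is AW's `L` up to this renaming of the witnesses, and the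
Boolean points at stake at stage `i` are the `2ⁿ` *candidates* `AWSeparation.cands n ⊆ {0,1}^{3n+2}`.

A state (`AWSeparation.St`) is the finite Boolean oracle `B` built so far, the extension oracle
`E` fixed so far — a polynomial for EVERY prime `p` and arity `m`, identically `0` above the
frozen bound (AW (ii): "if `Mᵢ` queries some `Ã_{n,F}(y)` with `n ∉ Tᵢ`, return `0`") — and the
frozen bound `N` (AW's set `Tᵢ` of fixed arities is replaced by the initial segment `≤ N`, as in
`BGS.St`). Stage `i` (`AWSeparation.next`) takes `n = BGS.lvl qᵢ N`, runs `Mᵢ` on `1ⁿ` for `qᵢ(n)`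
rounds against `E` (`stRes`, `stQs`), and collects the `< 2ⁿ` queried points of arity `3n + 2`
over all prime fields (`stT`, `arityPts`; a query string of length `ℓ` concerns an arity `≤ ℓ`,
`arity_le_length_of_decode`). "If `Mᵢ` accepted on input `1^{nᵢ}`, then fix `Ã_{nᵢ,F} := 0` for
all `F`, so that `L(nᵢ) = 0`" — nothing changes. "On the other hand, if `Mᵢ` rejected, then …
by Lemma 4.5, there exists a Boolean point `w` such that for all `F`, we can fix `Ã_{nᵢ,F}` to be a
multiquadratic polynomial such that (i') `Ã_{nᵢ,F}(y) = 0` for all `y ∈ Y_F`, (ii')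
`Ã_{nᵢ,F}(w) = 1`, and (iii') `Ã_{nᵢ,F}(z) = 0` for all Boolean `z ≠ w`" — the candidate `w`
(`stZY`, from `exists_good_cand`) is put into `B` and the arity-`(3n+2)` polynomials are replaced
by the `u_p` (`stU`, `ExtensionOracle.update`). Then every query made and every arity `≤ 3n + 2`
is frozen. Invariants: every stage's `E` is a multiquadratic extension of its `B`
(`stage_isExtensionOf`); strings and polynomials below the frozen bound never change again
(`mem_B_iff_of_le`, `poly_eq_of_le`), so the limits `A = ⋃ᵢ Bᵢ` (`oracleB`) and `Ã` (`extB`,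
arity `m` read off stage `m`) satisfy `Ã.IsExtensionOf A 2` (`extB_isExtensionOf`); the run of
`Mᵢ` on `1^{nᵢ}` against `Ã` is the stage run (`run_extB_eq`: frozen arities are unchanged, and
at the stage arity the new polynomials vanish at every queried point while the old ones were `0`);
and that run errs on `1^{nᵢ} ∈ U_A` (`U_not_mem_PRel`, verbatim the BGS argument). Hence
`U_A ∈ NP^A`, `U_A ∉ P^Ã`.

Scope remarks. (1) The tree's extension oracles range over the prime fields `𝔽_p` only (AW: all
finite fields; `Algebrization.lean`, design notes), which can only weaken `P^Ã`, so the statement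
proved is implied by — and its proof is verbatim — the printed one. (2) AW diagonalize against
`DTIME(n^{log n})` machines, so that one oracle defeats every polynomial clock; the vendored fact
is about `P^Ã`, and the tree's `PRel` comes with a polynomial clock per machine, so the
enumeration is over (machine, polynomial) pairs exactly as in `BakerGillSolovay.lean`.

## References

* S. Aaronson, A. Wigderson, *Algebrization: a new barrier in complexity theory*, STOC 2008 /
  ACM TOCT 1 (2009), Thm. 5.3 and its proof (full version pp. 23–24), Lemma 4.5 (pp. 19–20),
  Def. 2.2 [AaronsonWigderson2008].
* S. Arora, B. Barak, *Computational Complexity: A Modern Approach*, CUP 2009, Thm. 3.7 and its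
  proof (pp. 74–75) [AroraBarakCC2009].
* K.-I Ko, *Constructing oracles by lower bound techniques for circuits*, in: Combinatorics,
  Computing and Complexity (Kluwer, 1989) 30–76, §3 (pp. 10–11: stage construction, frozen
  bound `t(n)`) [Ko1989].
-/

noncomputable section

namespace Literature.Computability.Complexity

open _root_.Computability Polynomial MvPolynomial

/-! ### Replacing one arity of an extension oracle -/

namespace ExtensionOracle

/-- `E.update ℓ u`: the extension oracle `E` with its arity-`ℓ` polynomials (over every prime
field) replaced by `u`. [cite: AaronsonWigderson2008, Thm. 5.3 (proof: "fix `Ã_{nᵢ,F}`")] -/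
def update (E : ExtensionOracle) (ℓ : ℕ) (u : ∀ p : Nat.Primes, MvPolynomial (Fin ℓ) (ZMod p)) :
    ExtensionOracle where
  poly p m := if h : m = ℓ then h ▸ u p else E.poly p m

/-- The updated arity. [folklore] -/
@[simp] theorem update_poly_self (E : ExtensionOracle) (ℓ : ℕ)
    (u : ∀ p : Nat.Primes, MvPolynomial (Fin ℓ) (ZMod p)) (p : Nat.Primes) :
    (E.update ℓ u).poly p ℓ = u p := by
  simp [update]

/-- The other arities are unchanged. [folklore] -/
theorem update_poly_of_ne (E : ExtensionOracle) {ℓ m : ℕ}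
    (u : ∀ p : Nat.Primes, MvPolynomial (Fin ℓ) (ZMod p)) (p : Nat.Primes) (h : m ≠ ℓ) :
    (E.update ℓ u).poly p m = E.poly p m := by
  simp [update, h]

end ExtensionOracle

namespace AWSeparation

/-! ### The queried points of one arity -/

/-- The point of arity `ℓ` reached by the query string `y`, if any: the modulus `p` (a natural
number; non-prime moduli are answered `[]` by every extension oracle and are harmless) and the
coordinates `x ∈ ℕ^ℓ` of the decoded query `(p, ℓ, x)`. [cite: AaronsonWigderson2008, Thm. 5.3 (proof: "let `Y_F` be the set of all `y ∈ F^{nᵢ}` that `Mᵢ` queried")] -/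
def arityPt (ℓ : ℕ) (y : List Bool) : Option (ℕ × (Fin ℓ → ℕ)) :=
  match encodingExtQuery.decode y with
  | none => none
  | some ⟨p, m, x⟩ => if h : m = ℓ then some (p, fun i => x (Fin.cast h.symm i)) else none

/-- The points of arity `ℓ` reached by a list of queries. [cite: AaronsonWigderson2008, Thm. 5.3 (proof)] -/
def arityPts (ℓ : ℕ) (Qs : List (List Bool)) : Finset (ℕ × (Fin ℓ → ℕ)) :=
  (Qs.filterMap (arityPt ℓ)).toFinset

/-- No more points than queries. [cite: AaronsonWigderson2008, Thm. 5.3 (proof: "`Σ_F |Y_F| ≤ n^{log n}`")] -/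
theorem card_arityPts_le (ℓ : ℕ) (Qs : List (List Bool)) : (arityPts ℓ Qs).card ≤ Qs.length :=
  (List.toFinset_card_le _).trans (List.length_filterMap_le _ _)

/-- A query decoding to an arity-`ℓ` point contributes that point. [cite: AaronsonWigderson2008, Thm. 5.3 (proof)] -/
theorem mem_arityPts {ℓ : ℕ} {Qs : List (List Bool)} {y : List Bool} (hy : y ∈ Qs) {p : ℕ}
    {x : Fin ℓ → ℕ} (hd : encodingExtQuery.decode y = some ⟨p, ℓ, x⟩) : (p, x) ∈ arityPts ℓ Qs := by
  simp only [arityPts, List.mem_toFinset, List.mem_filterMap]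
  refine ⟨y, hy, ?_⟩
  simp only [arityPt, hd, dite_true]
  rfl

/-! ### The candidate Boolean points `⟨1ⁿ, y⟩`, `|y| = n` -/

/-- The Boolean point of `{0,1}^{3n+2}` spelled by the string `⟨1ⁿ, y⟩` for `y = List.ofFn z`,
`z ∈ {0,1}ⁿ` (the strings the stage may put into the oracle, as in the tree's Baker–Gill–Solovay
proof `BGS.stAdd`). [cite: AaronsonWigderson2008, Thm. 5.3 (proof)] [cite: AroraBarakCC2009, Thm. 3.7 (proof)] -/
def cand (n : ℕ) (z : Fin n → Bool) : Fin (3 * n + 2) → Bool :=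
  fun i => (boolPair (ones n) (List.ofFn z)).get
    ⟨i, by rw [length_boolPair, List.length_replicate, List.length_ofFn]; omega⟩

/-- The candidate point spells `⟨1ⁿ, List.ofFn z⟩`. [folklore] -/
theorem ofFn_cand (n : ℕ) (z : Fin n → Bool) : List.ofFn (cand n z) = boolPair (ones n) (List.ofFn z) := by
  apply List.ext_getElem
  · rw [List.length_ofFn, length_boolPair, List.length_replicate, List.length_ofFn]
    omega
  · intro i h₁ h₂
    simp only [List.getElem_ofFn, cand, List.get_eq_getElem]

/-- Distinct `z` give distinct candidate points. [folklore] -/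
theorem cand_injective (n : ℕ) : Function.Injective (cand n) := by
  intro z z' h
  have h1 := congrArg List.ofFn h
  rw [ofFn_cand, ofFn_cand] at h1
  have h2 := congrArg boolUnpair h1
  simp only [boolUnpair_boolPair, Prod.mk.injEq, true_and] at h2
  exact List.ofFn_injective h2

/-- The set of the `2ⁿ` candidate points. [cite: AaronsonWigderson2008, Thm. 5.3 (proof)] -/
def cands (n : ℕ) : Finset (Fin (3 * n + 2) → Bool) :=
  Finset.univ.image (cand n)

/-- There are `2ⁿ` candidate points. [folklore] -/
theorem card_cands (n : ℕ) : (cands n).card = 2 ^ n := by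
  rw [cands, Finset.card_image_of_injective _ (cand_injective n), Finset.card_univ]
  simp

/-- **The algebraic adversary step (AW Lemma 4.5 as used in Thm. 5.3).** If fewer than `2ⁿ` points
of arity `3n + 2` have been queried (`T`), then some candidate Boolean point `⟨1ⁿ, y⟩`, `|y| = n`,
is good for every prime field at once: for every prime `p` there is a multiquadratic
`u_p ∈ 𝔽_p[x₁, …, x_{3n+2}]` vanishing at the queried points over `𝔽_p`, equal to `1` at the
candidate and to `0` at every other Boolean point (AW: "by Lemma 4.5, there exists a Boolean
point `w` such that for all `F`, we can fix `Ã_{nᵢ,F}` to be a multiquadratic polynomial such that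
(i') `Ã_{nᵢ,F}(y) = 0` for all `y ∈ Y_F`, (ii') `Ã_{nᵢ,F}(w) = 1`, (iii') `Ã_{nᵢ,F}(z) = 0` for all
Boolean `z ≠ w`"). [cite: AaronsonWigderson2008, Thm. 5.3 (proof) and Lemma 4.5] -/
theorem exists_good_cand (n : ℕ) (T : Finset (ℕ × (Fin (3 * n + 2) → ℕ))) (hT : T.card < 2 ^ n) :
    ∃ zy : (Fin (3 * n + 2) → Bool) × List Bool, zy.2.length = n ∧
      List.ofFn zy.1 = boolPair (ones n) zy.2 ∧
      ∀ p : Nat.Primes, ∃ u : MvPolynomial (Fin (3 * n + 2)) (ZMod p),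
        (∀ i, u.degreeOf i ≤ 2) ∧
        (∀ v : Fin (3 * n + 2) → ℕ, ((p : ℕ), v) ∈ T → eval (fun i => (v i : ZMod p)) u = 0) ∧
        ∀ w : Fin (3 * n + 2) → Bool, eval (Multilinear.boolPt w) u = if w = zy.1 then 1 else 0 := by
  obtain ⟨w, hw, hgood⟩ := Multilinear.exists_multiquadratic_toggle (cands n) T (by rwa [card_cands])
  obtain ⟨z, -, rfl⟩ := Finset.mem_image.1 hw
  exact ⟨(cand n z, List.ofFn z), List.length_ofFn, ofFn_cand n z, hgood⟩

/-! ### States and stages -/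

/-- The state after a number of stages: the finite set `B` of strings put into the Boolean oracle
so far, the extension oracle `E` fixed so far (identically `0` at the arities not yet touched),
and the bound `N` freezing every arity (and every string of length) `≤ N`.
[cite: AaronsonWigderson2008, Thm. 5.3 (proof: "the set `Tᵢ` of fixed indices")] [cite: Ko1989, §3 (pp. 10–11)] -/
structure St where
  /-- strings put into the Boolean oracle so far -/
  B : Finset (List Bool)
  /-- the extension oracle fixed so far -/
  E : ExtensionOracle
  /-- all arities `≤ N` are frozen -/
  N : ℕ

/-- The language of a state (its finite set of strings). [folklore] -/
def St.lang (s : St) : Set (List Bool) := ↑s.B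

variable (D : OracleAlg Bool × Polynomial ℕ) (s : St)

/-- The input length `n` of a stage: fresh (`> N`) with `q(n) < 2ⁿ` (`BGS.lvl`; AW: "let `nᵢ` be
the least `n` such that `n ∉ Tᵢ` and `2ⁿ > n^{log n}`"). [cite: AaronsonWigderson2008, Thm. 5.3 (proof)] -/
def stLvl : ℕ := BGS.lvl D.2 s.N

/-- The stage run: the algorithm on `1ⁿ` for `q(n)` rounds against the extension oracle fixed so
far (untouched arities answer `0`: AW (ii) "if `Mᵢ` queries some `Ã_{n,F}(y)` with `n ∉ Tᵢ`,
return `0`"). [cite: AaronsonWigderson2008, Thm. 5.3 (proof)] -/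
def stRes : Option Bool :=
  D.1.run s.E.toOracle (D.2.eval (stLvl D s)) (ones (stLvl D s))

/-- The queries of the stage run. [cite: AaronsonWigderson2008, Thm. 5.3 (proof)] -/
def stQs : List (List Bool) :=
  D.1.queries s.E.toOracle (D.2.eval (stLvl D s)) (ones (stLvl D s))

/-- The points of the stage arity `3n + 2` queried by the stage run (AW's `Y_F`, all `F` at once).
[cite: AaronsonWigderson2008, Thm. 5.3 (proof)] -/
def stT : Finset (ℕ × (Fin (3 * stLvl D s + 2) → ℕ)) :=
  arityPts (3 * stLvl D s + 2) (stQs D s)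

/-- Fewer than `2ⁿ` points of the stage arity are queried. [cite: AaronsonWigderson2008, Thm. 5.3 (proof: "`Σ_F |Y_F| ≤ n^{log n}`" and "`2ⁿ > n^{log n}`")] -/
theorem card_stT_lt : (stT D s).card < 2 ^ stLvl D s :=
  lt_of_le_of_lt ((card_arityPts_le _ _).trans (D.1.length_queries_le _ _ _)) (BGS.eval_lvl_lt _ _)

/-- The good candidate point of the stage and the string `y` it spells (`⟨1ⁿ, y⟩`).
[cite: AaronsonWigderson2008, Thm. 5.3 (proof: the Boolean point `w`)] -/
def stZY : (Fin (3 * stLvl D s + 2) → Bool) × List Bool :=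
  Classical.choose (exists_good_cand (stLvl D s) (stT D s) (card_stT_lt D s))

/-- Specification of the good candidate point. [cite: AaronsonWigderson2008, Thm. 5.3 (proof)] -/
theorem stZY_spec :
    (stZY D s).2.length = stLvl D s ∧ List.ofFn (stZY D s).1 = boolPair (ones (stLvl D s)) (stZY D s).2 ∧
      ∀ p : Nat.Primes, ∃ u : MvPolynomial (Fin (3 * stLvl D s + 2)) (ZMod p),
        (∀ i, u.degreeOf i ≤ 2) ∧
        (∀ v : Fin (3 * stLvl D s + 2) → ℕ, ((p : ℕ), v) ∈ stT D s →
          eval (fun i => (v i : ZMod p)) u = 0) ∧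
        ∀ w : Fin (3 * stLvl D s + 2) → Bool,
          eval (Multilinear.boolPt w) u = if w = (stZY D s).1 then 1 else 0 :=
  Classical.choose_spec (exists_good_cand (stLvl D s) (stT D s) (card_stT_lt D s))

/-- The multiquadratic polynomials `Ã_{3n+2,𝔽_p}` fixed at a rejecting stage.
[cite: AaronsonWigderson2008, Thm. 5.3 (proof: (i')–(iii'))] -/
def stU (p : Nat.Primes) : MvPolynomial (Fin (3 * stLvl D s + 2)) (ZMod p) :=
  Classical.choose ((stZY_spec D s).2.2 p)

/-- Specification of the fixed polynomials: multiquadratic, `0` at the queried points, the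
indicator of the good candidate on the cube. [cite: AaronsonWigderson2008, Thm. 5.3 (proof: (i')–(iii'))] -/
theorem stU_spec (p : Nat.Primes) :
    (∀ i, (stU D s p).degreeOf i ≤ 2) ∧
      (∀ v : Fin (3 * stLvl D s + 2) → ℕ, ((p : ℕ), v) ∈ stT D s →
        eval (fun i => (v i : ZMod p)) (stU D s p) = 0) ∧
      ∀ w : Fin (3 * stLvl D s + 2) → Bool,
        eval (Multilinear.boolPt w) (stU D s p) = if w = (stZY D s).1 then 1 else 0 :=
  Classical.choose_spec ((stZY_spec D s).2.2 p)

/-- **One stage** (AW, proof of Thm. 5.3: "If `Mᵢ` accepted on input `1^{nᵢ}`, then fix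
`Ã_{nᵢ,F} := 0` for all `F`, so that `L(nᵢ) = 0`. On the other hand, if `Mᵢ` rejected, then …
fix `Ã_{nᵢ,F}` to be a multiquadratic polynomial [vanishing on the queried points and equal to the
indicator of the good Boolean point `w`]", putting the string `w` into `A`), followed by freezing
every query made and every arity `≤ 3n + 2`. [cite: AaronsonWigderson2008, Thm. 5.3 (proof)] -/
def next : St where
  B := if stRes D s = some false then insert (List.ofFn (stZY D s).1) s.B else s.B
  E := if stRes D s = some false then s.E.update (3 * stLvl D s + 2) (stU D s) else s.E
  N := 3 * stLvl D s + 2 + ((stQs D s).map List.length).sum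

variable (d : ℕ → OracleAlg Bool × Polynomial ℕ)

/-- The stages of the construction against the enumeration `d` of (algorithm, clock) pairs,
from the empty Boolean oracle and the identically-zero extension oracle.
[cite: AaronsonWigderson2008, Thm. 5.3 (proof: "the construction of `Ã` proceeds in stages")] -/
def stage : ℕ → St
  | 0 => ⟨∅, ⟨fun _ _ => 0⟩, 0⟩
  | i + 1 => next (d i) (stage i)

/-- **The Boolean oracle** `A = ⋃ᵢ Aᵢ`. [cite: AaronsonWigderson2008, Thm. 5.3] -/
def oracleB : Set (List Bool) :=
  {s | ∃ i, s ∈ (stage d i).B}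

/-- **The extension oracle `Ã`**: at arity `m`, the polynomials of stage `m` (frozen from then on:
`poly_stage_eq_extB`). [cite: AaronsonWigderson2008, Thm. 5.3] -/
def extB : ExtensionOracle where
  poly p m := (stage d m).E.poly p m

/-- The input length of stage `i` (reducible shorthand). [cite: AaronsonWigderson2008, Thm. 5.3 (proof: `nᵢ`)] -/
abbrev lv (i : ℕ) : ℕ := stLvl (d i) (stage d i)

/-- Stage `i + 1` unfolds to `next`. [folklore] -/
theorem stage_succ (i : ℕ) : stage d (i + 1) = next (d i) (stage d i) := rfl

/-- The frozen bound is below the stage length. [cite: AaronsonWigderson2008, Thm. 5.3 (proof: "`nᵢ ∉ Tᵢ`")] -/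
theorem N_lt_lv (i : ℕ) : (stage d i).N < lv d i :=
  BGS.lt_lvl _ _

/-- The next frozen bound covers the stage arity `3n + 2`. [cite: AaronsonWigderson2008, Thm. 5.3 (proof)] -/
theorem ar_le_N_succ (i : ℕ) : 3 * lv d i + 2 ≤ (stage d (i + 1)).N := by
  rw [stage_succ]
  change 3 * lv d i + 2 ≤ 3 * lv d i + 2 + _
  omega

/-- The next frozen bound covers every query of the stage run. [cite: AaronsonWigderson2008, Thm. 5.3 (proof: "`Sᵢ`, the indices queried, are fixed")] -/
theorem length_le_N_succ_of_mem_stQs (i : ℕ) {y : List Bool} (hy : y ∈ stQs (d i) (stage d i)) :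
    y.length ≤ (stage d (i + 1)).N := by
  rw [stage_succ]
  change y.length ≤ 3 * lv d i + 2 + ((stQs (d i) (stage d i)).map List.length).sum
  have : y.length ≤ ((stQs (d i) (stage d i)).map List.length).sum :=
    List.single_le_sum (fun _ _ => Nat.zero_le _) _ (List.mem_map.2 ⟨y, hy, rfl⟩)
  omega

/-- The frozen bounds increase. [folklore] -/
theorem N_lt_N_succ (i : ℕ) : (stage d i).N < (stage d (i + 1)).N :=
  lt_of_lt_of_le (lt_of_lt_of_le (N_lt_lv d i) (by omega)) (ar_le_N_succ d i)

/-- The frozen bounds are monotone. [folklore] -/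
theorem N_mono {i j : ℕ} (h : i ≤ j) : (stage d i).N ≤ (stage d j).N := by
  induction h with
  | refl => exact le_rfl
  | step _ ih => exact ih.trans (N_lt_N_succ d _).le

/-- The frozen bound of stage `i` is at least `i`. [folklore] -/
theorem le_N (i : ℕ) : i ≤ (stage d i).N := by
  induction i with
  | zero => exact Nat.zero_le _
  | succ i ih => exact Nat.succ_le_of_lt (lt_of_le_of_lt ih (N_lt_N_succ d i))

/-! ### What a stage changes -/

/-- Membership in the next stage's Boolean oracle. [folklore] -/
theorem mem_B_succ_iff (i : ℕ) (s : List Bool) :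
    s ∈ (stage d (i + 1)).B ↔
      s ∈ (stage d i).B ∨
        (stRes (d i) (stage d i) = some false ∧ s = List.ofFn (stZY (d i) (stage d i)).1) := by
  rw [stage_succ]
  change s ∈ (if stRes (d i) (stage d i) = some false then _ else _) ↔ _
  split_ifs with h
  · rw [Finset.mem_insert]
    tauto
  · tauto

/-- The string added at a rejecting stage has the stage arity as its length. [folklore] -/
theorem length_add (i : ℕ) : (List.ofFn (stZY (d i) (stage d i)).1).length = 3 * lv d i + 2 :=
  List.length_ofFn

/-- The string added at a rejecting stage is `⟨1ⁿ, y⟩` for some `y` of length `n`.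
[cite: AaronsonWigderson2008, Thm. 5.3 (proof)] -/
theorem add_spec (i : ℕ) :
    ∃ y : List Bool, y.length = lv d i ∧ List.ofFn (stZY (d i) (stage d i)).1 = boolPair (ones (lv d i)) y :=
  ⟨_, (stZY_spec (d i) (stage d i)).1, (stZY_spec (d i) (stage d i)).2.1⟩

/-- The polynomials of the next stage at an arity other than the stage arity are unchanged.
[cite: AaronsonWigderson2008, Thm. 5.3 (proof)] -/
theorem poly_succ_of_ne (i : ℕ) (p : Nat.Primes) {m : ℕ} (hm : m ≠ 3 * lv d i + 2) :
    (stage d (i + 1)).E.poly p m = (stage d i).E.poly p m := by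
  rw [stage_succ]
  change (if stRes (d i) (stage d i) = some false then _ else _ : ExtensionOracle).poly p m = _
  split_ifs with h
  · exact ExtensionOracle.update_poly_of_ne _ _ p hm
  · rfl

/-- The stages are cumulative. [folklore] -/
theorem B_mono {i j : ℕ} (h : i ≤ j) : (stage d i).B ⊆ (stage d j).B := by
  induction h with
  | refl => exact Finset.Subset.refl _
  | step _ ih => exact ih.trans fun s hs => (mem_B_succ_iff d _ s).2 (Or.inl hs)

/-- Every string of stage `i` has length at most the frozen bound `Nᵢ`. [cite: Ko1989, §3 (p. 11)] -/
theorem length_le_N_of_mem {i : ℕ} {s : List Bool} (hs : s ∈ (stage d i).B) :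
    s.length ≤ (stage d i).N := by
  induction i with
  | zero => exact absurd hs (Finset.notMem_empty s)
  | succ i ih =>
    rcases (mem_B_succ_iff d i s).1 hs with h | ⟨-, rfl⟩
    · exact (ih h).trans (N_lt_N_succ d i).le
    · rw [length_add]
      exact ar_le_N_succ d i

/-- Above the frozen bound the extension oracle of a stage is identically `0` (AW (ii): arities
not yet fixed answer `0`). [cite: AaronsonWigderson2008, Thm. 5.3 (proof)] -/
theorem poly_eq_zero_of_N_lt {i : ℕ} (p : Nat.Primes) {m : ℕ} (hm : (stage d i).N < m) :
    (stage d i).E.poly p m = 0 := by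
  induction i with
  | zero => rfl
  | succ i ih =>
    have h1 := ar_le_N_succ d i
    rw [poly_succ_of_ne d i p (by omega)]
    exact ih (lt_trans (N_lt_N_succ d i) hm)

/-- **Freezing (Boolean oracle)**: a string of length `≤ Nᵢ` belongs to a later stage iff it
belongs to stage `i`. [cite: AaronsonWigderson2008, Thm. 5.3 (proof)] [cite: Ko1989, §3 (p. 11)] -/
theorem mem_B_iff_of_le {i : ℕ} {s : List Bool} (hs : s.length ≤ (stage d i).N) :
    ∀ {j : ℕ}, i ≤ j → (s ∈ (stage d j).B ↔ s ∈ (stage d i).B) := by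
  intro j hj
  induction hj with
  | refl => exact Iff.rfl
  | @step j hij ih =>
    rw [← ih, mem_B_succ_iff]
    constructor
    · rintro (h | ⟨-, h⟩)
      · exact h
      · exfalso
        have h1 := length_add d j
        have h2 := N_lt_lv d j
        have h3 := N_mono d hij
        rw [← h] at h1
        omega
    · exact Or.inl

/-- **Freezing (extension oracle)**: the polynomials at an arity `≤ Nᵢ` do not change after
stage `i` (later stages touch only their own, larger, arity). [cite: AaronsonWigderson2008, Thm. 5.3 (proof: "it will not change in stage `i` or any later stage")] -/
theorem poly_eq_of_le {i : ℕ} (p : Nat.Primes) {m : ℕ} (hm : m ≤ (stage d i).N) :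
    ∀ {j : ℕ}, i ≤ j → (stage d j).E.poly p m = (stage d i).E.poly p m := by
  intro j hj
  induction hj with
  | refl => rfl
  | @step j hij ih =>
    rw [← ih]
    have h2 := N_lt_lv d j
    have h3 := N_mono d hij
    exact poly_succ_of_ne d j p (by omega)

/-- **Freezing for the limit Boolean oracle.** [cite: AaronsonWigderson2008, Thm. 5.3 (proof)] -/
theorem mem_oracleB_iff_of_le {i : ℕ} {s : List Bool} (hs : s.length ≤ (stage d i).N) :
    s ∈ oracleB d ↔ s ∈ (stage d i).B := by
  constructor
  · rintro ⟨j, hj⟩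
    rcases le_total i j with hij | hji
    · exact (mem_B_iff_of_le d hs hij).1 hj
    · exact B_mono d hji hj
  · intro h
    exact ⟨i, h⟩

/-- **Freezing for the limit extension oracle**: at an arity `m ≤ Nᵢ`, `Ã` has the polynomials of
stage `i`. [cite: AaronsonWigderson2008, Thm. 5.3 (proof)] -/
theorem extB_poly_eq {i : ℕ} (p : Nat.Primes) {m : ℕ} (hm : m ≤ (stage d i).N) :
    (extB d).poly p m = (stage d i).E.poly p m := by
  change (stage d m).E.poly p m = _
  rcases le_total i m with him | hmi
  · exact poly_eq_of_le d p hm him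
  · exact (poly_eq_of_le d p (le_N d m) hmi).symm

/-! ### `Ã` extends `A` with multidegree `2` -/

/-- The Boolean slice of a finite set of strings after inserting a string of a fresh length `ℓ`:
at arity `ℓ` it is the indicator of the new string. [folklore] -/
theorem sliceFn_insert_ofFn {B : Finset (List Bool)} {ℓ : ℕ} (hB : ∀ s ∈ B, s.length < ℓ)
    (z x : Fin ℓ → Bool) :
    Language.sliceFn (↑(insert (List.ofFn z) B) : Set (List Bool)) ℓ x = decide (x = z) := by
  unfold Language.sliceFn
  by_cases h : x = z
  · subst h
    simpa using (Set.mem_iff_boolIndicator _ _).1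
      (show List.ofFn x ∈ (↑(insert (List.ofFn x) B) : Set (List Bool)) by simp)
  · rw [decide_eq_false h]
    refine (Set.notMem_iff_boolIndicator _ _).1 fun hx => ?_
    simp only [Finset.coe_insert, Set.mem_insert_iff, Finset.mem_coe] at hx
    rcases hx with hx | hx
    · exact h (List.ofFn_injective hx)
    · exact absurd (hB _ hx) (by simp)

/-- Inserting a string of length `ℓ` does not change the slices at other arities. [folklore] -/
theorem sliceFn_insert_of_ne {B : Finset (List Bool)} {s : List Bool} {m : ℕ} (h : s.length ≠ m) :
    Language.sliceFn (↑(insert s B) : Set (List Bool)) m = Language.sliceFn (↑B : Set (List Bool)) m :=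
  sliceFn_congr fun w hw => by
    have key : w ∈ (↑(insert s B) : Set (List Bool)) ↔ w = s ∨ w ∈ (↑B : Set (List Bool)) := by
      rw [Finset.coe_insert, Set.mem_insert_iff]
    exact key.trans ⟨fun h' => h'.resolve_left (by rintro rfl; exact h hw), Or.inr⟩

/-- **Stage invariant**: the extension oracle of every stage is a multiquadratic extension of its
Boolean oracle (AW: the polynomials are "fixed consistently"; untouched arities: `0` extends the
empty slice). [cite: AaronsonWigderson2008, Thm. 5.3 (proof)] -/
theorem stage_isExtensionOf (i : ℕ) : (stage d i).E.IsExtensionOf (stage d i).lang 2 := by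
  induction i with
  | zero =>
    intro p m
    refine ⟨fun j => ?_, fun x => ?_⟩
    · change MvPolynomial.degreeOf j (0 : MvPolynomial (Fin m) (ZMod p)) ≤ 2
      rw [degreeOf_zero]
      exact Nat.zero_le _
    · have h0 : Language.sliceFn (stage d 0).lang m x = false :=
        (Set.notMem_iff_boolIndicator _ _).1 (by simp [stage, St.lang])
      rw [h0]
      change MvPolynomial.eval _ (0 : MvPolynomial (Fin m) (ZMod p)) = _
      rw [map_zero]
      simp
  | succ i ih =>
    intro p m
    by_cases hres : stRes (d i) (stage d i) = some false
    · have hE : (stage d (i + 1)).E = (stage d i).E.update (3 * lv d i + 2) (stU (d i) (stage d i)) := by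
        rw [stage_succ]; exact if_pos hres
      have hB : (stage d (i + 1)).lang =
          ↑(insert (List.ofFn (stZY (d i) (stage d i)).1) (stage d i).B) := by
        rw [stage_succ]; exact congrArg (fun t : Finset (List Bool) => (↑t : Set (List Bool))) (if_pos hres)
      rw [hE, hB]
      by_cases hm : m = 3 * lv d i + 2
      · subst hm
        rw [ExtensionOracle.update_poly_self]
        refine ⟨(stU_spec (d i) (stage d i) p).1, fun x => ?_⟩
        have hfresh : ∀ s ∈ (stage d i).B, s.length < 3 * lv d i + 2 := fun s hs =>
          lt_of_le_of_lt (length_le_N_of_mem d hs) (lt_of_lt_of_le (N_lt_lv d i) (by omega))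
        rw [sliceFn_insert_ofFn hfresh]
        refine ((stU_spec (d i) (stage d i) p).2.2 x).trans ?_
        by_cases hx : x = (stZY (d i) (stage d i)).1 <;> simp [hx]
      · rw [ExtensionOracle.update_poly_of_ne _ _ p hm, sliceFn_insert_of_ne (by rw [length_add d i]; exact Ne.symm hm)]
        exact ih p m
    · have hE : (stage d (i + 1)).E = (stage d i).E := by rw [stage_succ]; exact if_neg hres
      have hB : (stage d (i + 1)).lang = (stage d i).lang := by
        rw [stage_succ]; exact congrArg (fun t : Finset (List Bool) => (↑t : Set (List Bool))) (if_neg hres)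
      rw [hE, hB]
      exact ih p m

/-- **`Ã` is an extension of `A` of multidegree `≤ 2`** (multiquadratic), arity by arity the
stage invariant at the freezing stage. [cite: AaronsonWigderson2008, Thm. 5.3] -/
theorem extB_isExtensionOf : (extB d).IsExtensionOf (oracleB d) 2 := by
  intro p m
  have hslice : Language.sliceFn (oracleB d) m = Language.sliceFn (stage d m).lang m :=
    sliceFn_congr fun w hw => mem_oracleB_iff_of_le d (hw ▸ le_N d m)
  rw [hslice]
  exact stage_isExtensionOf d m p m

/-! ### The run against `Ã` is the stage run -/

/-- `Ã` answers the queries of the stage-`i` run as the stage-`i` extension oracle did: a query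
of length `≤ Nᵢ₊₁` concerns an arity `m ≤ Nᵢ₊₁`, frozen from stage `i + 1` on; stage `i` itself
changed only the stage arity, where the new polynomials vanish at every queried point and the old
ones were `0`. [cite: AaronsonWigderson2008, Thm. 5.3 (proof: (i) and (i'))] -/
theorem extB_apply_of_mem_stQs (i : ℕ) {y : List Bool} (hy : y ∈ stQs (d i) (stage d i)) :
    (extB d).toOracle y = (stage d i).E.toOracle y := by
  refine ExtensionOracle.toOracle_congr_of_eval fun p m x hd => ?_
  have hm : m ≤ (stage d (i + 1)).N :=
    (arity_le_length_of_decode hd).trans (length_le_N_succ_of_mem_stQs d i hy)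
  rw [extB_poly_eq d p hm]
  by_cases hmar : m = 3 * lv d i + 2
  · subst hmar
    rw [poly_eq_zero_of_N_lt d p (lt_of_lt_of_le (N_lt_lv d i) (by omega)), map_zero, stage_succ]
    change eval _ ((if stRes (d i) (stage d i) = some false then _ else _ : ExtensionOracle).poly p _) = 0
    split_ifs with hres
    · rw [ExtensionOracle.update_poly_self]
      exact (stU_spec (d i) (stage d i) p).2.1 x (mem_arityPts hy hd)
    · rw [poly_eq_zero_of_N_lt d p (lt_of_lt_of_le (N_lt_lv d i) (by omega)), map_zero]
  · rw [poly_succ_of_ne d i p hmar]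

/-- **The run against `Ã` is the stage run.** [cite: AaronsonWigderson2008, Thm. 5.3 (proof)] -/
theorem run_extB_eq (i : ℕ) :
    (d i).1.run (extB d).toOracle ((d i).2.eval (lv d i)) (ones (lv d i)) = stRes (d i) (stage d i) :=
  (d i).1.run_congr fun _ hy => extB_apply_of_mem_stQs d i hy

/-! ### The diagonalization -/

/-- **`U_A ∉ P^Ã`** for `U_A = {x | ∃ y, |y| ≤ |x|, ⟨x, y⟩ ∈ A}` (`BGS.U`), provided the sequence
`d` contains every (polynomial-time algorithm, polynomial) pair: the pair `(Mᵢ, qᵢ)` errs on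
`1^{nᵢ}` — if the stage run rejected, the added string `⟨1ⁿ, y⟩`, `|y| = n`, puts `1ⁿ` into
`U_A`; if it did not, no `⟨1ⁿ, y⟩` with `|y| ≤ n` ever enters `A` (those strings are frozen at
stage `i + 1`, and stage `i` holds only shorter strings). (AW: "it suffices to ensure that for
every `i`, there exists an `n` such that `Mᵢ(n) ≠ L(n)`".) [cite: AaronsonWigderson2008, Thm. 5.3 (proof)] -/
theorem U_not_mem_PRel (hd : {D : OracleAlg Bool × Polynomial ℕ | D.1.IsPolyTime encodingBoolBool} ⊆ Set.range d) :
    BGS.U (oracleB d) ∉ PRel (extB d).toOracle := by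
  rintro ⟨M, hM, q, hq⟩
  obtain ⟨i, hi⟩ := hd (show (M, q) ∈ {D : OracleAlg Bool × Polynomial ℕ | _} from hM)
  have hM' : (d i).1 = M := by rw [hi]
  have hq' : (d i).2 = q := by rw [hi]
  set n := lv d i with hn
  have hrun := (hq (ones n)).1
  simp only [List.length_replicate] at hrun
  rw [← hM', ← hq', run_extB_eq d i] at hrun
  -- `hrun : stRes (d i) (stage d i) = some [1ⁿ ∈ U_A]`
  by_cases hres : stRes (d i) (stage d i) = some false
  · -- the stage added `⟨1ⁿ, y⟩`, `|y| = n`, so `1ⁿ ∈ U_A`, but the run said `false`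
    rw [hres, Option.some.injEq] at hrun
    obtain ⟨y, hy, hadd⟩ := add_spec d i
    have hmem : List.ofFn (stZY (d i) (stage d i)).1 ∈ (stage d (i + 1)).B :=
      (mem_B_succ_iff d i _).2 (Or.inr ⟨hres, rfl⟩)
    have hU : ones n ∈ BGS.U (oracleB d) :=
      ⟨y, by rw [hy, List.length_replicate], by rw [← hadd]; exact ⟨i + 1, hmem⟩⟩
    have h2 := (Set.mem_iff_boolIndicator _ _).1 hU
    rw [← hrun] at h2
    exact Bool.false_ne_true h2
  · -- the run said `true`, but no `⟨1ⁿ, y⟩`, `|y| ≤ n`, is ever put into `A`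
    have htrue : (BGS.U (oracleB d)).boolIndicator (ones n) = true := by
      rcases Bool.eq_false_or_eq_true ((BGS.U (oracleB d)).boolIndicator (ones n)) with h | h
      · exact h
      · exact absurd (hrun.trans (by rw [h])) hres
    obtain ⟨y, hy, hyB⟩ := (Set.mem_iff_boolIndicator _ _).2 htrue
    rw [List.length_replicate] at hy
    have hlen : (boolPair (ones n) y).length ≤ (stage d (i + 1)).N := by
      refine le_trans ?_ (ar_le_N_succ d i)
      rw [length_boolPair, List.length_replicate]
      omega
    have h1 := (mem_oracleB_iff_of_le d hlen).1 hyB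
    rcases (mem_B_succ_iff d i _).1 h1 with h2 | ⟨h2, -⟩
    · have h3 := length_le_N_of_mem d h2
      have h4 := N_lt_lv d i
      rw [length_boolPair, List.length_replicate] at h3
      omega
    · exact hres h2

end AWSeparation

/-! ### The theorem -/

/-- **Aaronson–Wigderson, Thm. 5.3** ("There exist `A, Ã` such that `NP^A ⊄ P^Ã`. Furthermore, the
language `L` that achieves the separation simply corresponds to deciding, on inputs of length `n`,
whether there exists a `w ∈ {0,1}ⁿ` with `Aₙ(w) = 1`"; hence "any proof of `P = NP` would require
non-algebrizing techniques"): discharge of the named fact `aaronson_wigderson_separation`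
(`StructuralPH.lean`) — there are an oracle language `A` and an extension `Ã` of `A` of
multidegree `≤ d` over the prime fields (here `d = 2`, multiquadratic, as in AW's proof) with
`¬ NPRel (Oracle.ofLanguage A) ⊆ PRel Ã.toOracle`, the separating language being
`U_A = {x | ∃ y, |y| ≤ |x|, ⟨x, y⟩ ∈ A} ∈ NP^A` (`BGS.U_mem_NPRel`; `A` holds only strings
`⟨1ⁿ, y⟩` with `|y| = n`). Axioms: `propext`, `Classical.choice`, `Quot.sound`.
[cite: AaronsonWigderson2008, Thm. 5.3 (full version pp. 23–24)] -/
theorem aaronson_wigderson_separation_holds : aaronson_wigderson_separation := by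
  obtain ⟨d, hd⟩ := BGS.exists_enum_pair
  exact ⟨AWSeparation.oracleB d, AWSeparation.extB d, 2, AWSeparation.extB_isExtensionOf d,
    fun hsub => AWSeparation.U_not_mem_PRel d hd (hsub (BGS.U_mem_NPRel _))⟩

end Literature.Computability.Complexity

end
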